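import Summits.KontsevichZagierPeriods.KontsevichZagierPeriods.Theorems.SymplecticScissorsRealOnePeriodRelationsStubCellsAux
import Mathlib.Analysis.SpecialFunctions.Sqrt

/-!
# `RealOnePeriodRelations` (stmt-KontsevichZagierPeriods-10042), line `nash-retraction-thin-strip`,
# the quartic-oval layer: the stub `stub_quarticTailCell`

`QuarticLayer.stub_quarticTailCell`: a convergent TAIL `∫_{M₀}^∞ c₀ dx/√q(x)` of an abelian integral of
the first kind on `y² = q(x) = a₄x⁴ + a₃x³ + a₂x² + a₁x + a₀` (real algebraic coefficients, `ε` a real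
root of `q` with `q > 0` on `(ε, ∞)`, `c₃ = q′(ε) > 0`, `M₀ > ε` algebraic) is, modulo `M₁`, the
integral of `c₀ dv/√D(v)` over the BOUNDED cell `(0, c₃/(M₀ − ε))`, where
`D(v) = v³ + c₂v² + c₁c₃v + a₄c₃²` is the monic resolvent cubic (`c₂ = q″(ε)/2 = 6a₄ε² + 3a₃ε + a₂`,
`c₁ = q‴(ε)/6 = 4a₄ε + a₃`), and `D > 0` on that cell. The move is the real Möbius chart
`φ(x) = c₃/(x − ε)`, a decreasing bijection `(M₀, ∞) → (0, c₃/(M₀ − ε))` with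
`φ′(x) = −c₃/(x − ε)²`. The Taylor expansion `q(ε + h) = c₃h + c₂h² + c₁h³ + a₄h⁴` (it uses
`q(ε) = 0`) gives the exact identity `D(φ(x)) · (x − ε)⁴ = c₃² · q(x)`, whence
`c₀/√q(x) = (c₀/√D(φ x)) · |φ′(x)|` on `(ε, ∞)` and the positivity of `D` on the image cell. So the
statement is ONE instance of Kontsevich–Zagier's rule (2) in dimension one, i.e. of the landed packaging
`helper_cells_1`: `φ`, `φ′` are `ℚ`-semialgebraic on the domain because `ε` and `c₃` are real
algebraic numbers.

References: M. Kontsevich, D. Zagier, *Periods* (2001), §1.2 rule (2); A. Huber, G. Wüstholz,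
*Transcendence and linear relations of 1-periods* (2022), §13.2.
-/

noncomputable section

open Set MeasureTheory Filter Topology
open Literature.NumberTheory.Transcendental Literature.ModelTheory.ExponentialFields
open Summit.KontsevichZagierPeriods.SymplecticScissors.RealOnePeriodRelationsNegative (M₁ H₁)

namespace Summit.KontsevichZagierPeriods.SymplecticScissors.RealOnePeriodRelations

namespace QuarticLayer

/-- Taylor expansion of a quartic at a root: if `q(ε) = 0` then
`q(x) = c₃(x − ε) + c₂(x − ε)² + c₁(x − ε)³ + a₄(x − ε)⁴` with `c₃ = q′(ε)`, `c₂ = q″(ε)/2`,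
`c₁ = q‴(ε)/6`. [folklore] -/
theorem quarticTail_taylor {a₄ a₃ a₂ a₁ a₀ ε : ℝ}
    (hq : a₄ * ε ^ 4 + a₃ * ε ^ 3 + a₂ * ε ^ 2 + a₁ * ε + a₀ = 0) (x : ℝ) :
    a₄ * x ^ 4 + a₃ * x ^ 3 + a₂ * x ^ 2 + a₁ * x + a₀ =
      (4 * a₄ * ε ^ 3 + 3 * a₃ * ε ^ 2 + 2 * a₂ * ε + a₁) * (x - ε) +
        (6 * a₄ * ε ^ 2 + 3 * a₃ * ε + a₂) * (x - ε) ^ 2 + (4 * a₄ * ε + a₃) * (x - ε) ^ 3 +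
        a₄ * (x - ε) ^ 4 := by
  have ha₀ : a₀ = -(a₄ * ε ^ 4 + a₃ * ε ^ 3 + a₂ * ε ^ 2 + a₁ * ε) := by linarith
  subst ha₀
  ring

/-- The rational identity behind the Möbius move `v = c₃/(x − ε)`: if `q(ε) = 0` and
`c = c₃ = q′(ε)`, then `D(c/(x − ε)) = (c/(x − ε)²)² · q(x)` for `x ≠ ε`, where
`D(v) = v³ + c₂v² + c₁cv + a₄c²` is the monic resolvent cubic. [folklore] -/
theorem quarticTail_identity {a₄ a₃ a₂ a₁ a₀ ε c x : ℝ}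
    (hq : a₄ * ε ^ 4 + a₃ * ε ^ 3 + a₂ * ε ^ 2 + a₁ * ε + a₀ = 0)
    (hc : 4 * a₄ * ε ^ 3 + 3 * a₃ * ε ^ 2 + 2 * a₂ * ε + a₁ = c) (hx : x ≠ ε) :
    (c / (x - ε)) ^ 3 + (6 * a₄ * ε ^ 2 + 3 * a₃ * ε + a₂) * (c / (x - ε)) ^ 2 +
        (4 * a₄ * ε + a₃) * c * (c / (x - ε)) + a₄ * c ^ 2 =
      (c / (x - ε) ^ 2) ^ 2 * (a₄ * x ^ 4 + a₃ * x ^ 3 + a₂ * x ^ 2 + a₁ * x + a₀) := by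
  rw [quarticTail_taylor hq x, hc]
  have hxe : x - ε ≠ 0 := sub_ne_zero.mpr hx
  field_simp

/-- Square roots of `quarticTail_identity` on `(ε, ∞)`: `√D(c/(x − ε)) = c/(x − ε)² · √q(x)` when
`c = q′(ε) > 0` and `x > ε`. [folklore] -/
theorem quarticTail_sqrt {a₄ a₃ a₂ a₁ a₀ ε c x : ℝ}
    (hq : a₄ * ε ^ 4 + a₃ * ε ^ 3 + a₂ * ε ^ 2 + a₁ * ε + a₀ = 0)
    (hc : 4 * a₄ * ε ^ 3 + 3 * a₃ * ε ^ 2 + 2 * a₂ * ε + a₁ = c) (hc0 : 0 < c) (hx : ε < x) :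
    Real.sqrt ((c / (x - ε)) ^ 3 + (6 * a₄ * ε ^ 2 + 3 * a₃ * ε + a₂) * (c / (x - ε)) ^ 2 +
        (4 * a₄ * ε + a₃) * c * (c / (x - ε)) + a₄ * c ^ 2) =
      c / (x - ε) ^ 2 * Real.sqrt (a₄ * x ^ 4 + a₃ * x ^ 3 + a₂ * x ^ 2 + a₁ * x + a₀) := by
  rw [quarticTail_identity hq hc hx.ne', Real.sqrt_mul (sq_nonneg _),
    Real.sqrt_sq (div_pos hc0 (pow_pos (sub_pos.2 hx) 2)).le]

/-- The inverse chart: for `v` in the image cell `(0, c/(M₀ − ε))` (`c > 0`, `ε < M₀`) the point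
`x = ε + c/v` lies in the tail `(M₀, ∞)` and `c/(x − ε) = v`. [folklore] -/
theorem quarticTail_inv {ε M₀ c v : ℝ} (hc0 : 0 < c) (hlt : ε < M₀)
    (hv : v ∈ Ioo 0 (c / (M₀ - ε))) : M₀ < ε + c / v ∧ c / (ε + c / v - ε) = v := by
  have hMε : 0 < M₀ - ε := sub_pos.2 hlt
  refine ⟨?_, by rw [add_sub_cancel_left, div_div_cancel₀ hc0.ne']⟩
  have h3 : M₀ - ε < c / v := by
    rw [lt_div_iff₀ hv.1]
    calc (M₀ - ε) * v < (M₀ - ε) * (c / (M₀ - ε)) := mul_lt_mul_of_pos_left hv.2 hMε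
      _ = c := mul_div_cancel₀ _ hMε.ne'
  linarith

/-- **Stub `stub_quarticTailCell` — a convergent first-kind quartic TAIL is ONE Möbius move away from
a bounded cell of the resolvent cubic** (rule 2). For the quartic `q = a₄x⁴ + a₃x³ + a₂x² + a₁x + a₀`
over `ℚ̄ ∩ ℝ`, a real root `ε` of `q` with `q > 0` on `(ε, ∞)` and `c₃ = q′(ε) > 0`, and an algebraic
`M₀ > ε`, the change of variables `v = c₃/(x − ε)` maps `(M₀, ∞)` onto the bounded interval
`(0, c₃/(M₀ − ε))`, on which the monic resolvent cubic `D(v) = v³ + c₂v² + c₁c₃v + a₄c₃²` is positive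
(positivity is inherited from `q`), and `c₀ dx/√q(x)` to `c₀ dv/√D(v)`: a representation on
`{M₀ < z 0}` with integrand `c₀/√q` differs by an element of `M₁` from one on
`{z 0 ∈ (0, c₃/(M₀ − ε))}` with integrand `c₀/√D` (push forward along `φ(x) = c₃/(x − ε)` with
`helper_cells_1`, using `dx/√q(x) = |dv|/√D(v)`).
[cite: KontsevichZagier2001, §1.2 (rule 2)] [cite: HuberWustholz2022, §13.2] -/
theorem stub_quarticTailCell (a₄ a₃ a₂ a₁ a₀ : ℝ) (ha₄ : IsAlgebraic ℚ a₄) (ha₃ : IsAlgebraic ℚ a₃)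
    (ha₂ : IsAlgebraic ℚ a₂) (ha₁ : IsAlgebraic ℚ a₁) (ha₀ : IsAlgebraic ℚ a₀)
    (ε M₀ c₀ : ℝ) (hε : IsAlgebraic ℚ ε) (hM₀ : IsAlgebraic ℚ M₀) (hc₀ : IsAlgebraic ℚ c₀) (hlt : ε < M₀)
    (hq : a₄ * ε ^ 4 + a₃ * ε ^ 3 + a₂ * ε ^ 2 + a₁ * ε + a₀ = 0)
    (hpos : ∀ x : ℝ, ε < x → 0 < a₄ * x ^ 4 + a₃ * x ^ 3 + a₂ * x ^ 2 + a₁ * x + a₀)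
    (hder : 0 < 4 * a₄ * ε ^ 3 + 3 * a₃ * ε ^ 2 + 2 * a₂ * ε + a₁)
    (r : KZ.IntegralRep 1) (hdom : r.domain = {z | M₀ < z 0})
    (hint : ∀ z ∈ r.domain, r.integrand z = c₀ / Real.sqrt (a₄ * (z 0) ^ 4 + a₃ * (z 0) ^ 3 + a₂ * (z 0) ^ 2 + a₁ * (z 0) + a₀)) :
    ∃ r' : KZ.IntegralRep 1,
      r'.domain = {z | z 0 ∈ Set.Ioo 0 ((4 * a₄ * ε ^ 3 + 3 * a₃ * ε ^ 2 + 2 * a₂ * ε + a₁) / (M₀ - ε))} ∧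
      (∀ z ∈ r'.domain, r'.integrand z = c₀ / Real.sqrt ((z 0) ^ 3 + (6 * a₄ * ε ^ 2 + 3 * a₃ * ε + a₂) * (z 0) ^ 2 +
        (4 * a₄ * ε + a₃) * (4 * a₄ * ε ^ 3 + 3 * a₃ * ε ^ 2 + 2 * a₂ * ε + a₁) * (z 0) +
        a₄ * (4 * a₄ * ε ^ 3 + 3 * a₃ * ε ^ 2 + 2 * a₂ * ε + a₁) ^ 2)) ∧
      (∀ v ∈ Set.Ioo 0 ((4 * a₄ * ε ^ 3 + 3 * a₃ * ε ^ 2 + 2 * a₂ * ε + a₁) / (M₀ - ε)),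
        0 < v ^ 3 + (6 * a₄ * ε ^ 2 + 3 * a₃ * ε + a₂) * v ^ 2 +
          (4 * a₄ * ε + a₃) * (4 * a₄ * ε ^ 3 + 3 * a₃ * ε ^ 2 + 2 * a₂ * ε + a₁) * v +
          a₄ * (4 * a₄ * ε ^ 3 + 3 * a₃ * ε ^ 2 + 2 * a₂ * ε + a₁) ^ 2) ∧
      KZ.of r - KZ.of r' ∈ M₁ := by
  -- `ha₀`, `hM₀`, `hc₀` belong to the registered signature but are not needed for the move
  have _h : IsAlgebraic ℚ a₀ ∧ IsAlgebraic ℚ M₀ ∧ IsAlgebraic ℚ c₀ := ⟨ha₀, hM₀, hc₀⟩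
  have hcalg : IsAlgebraic ℚ (4 * a₄ * ε ^ 3 + 3 * a₃ * ε ^ 2 + 2 * a₂ * ε + a₁) :=
    (((((isAlgebraic_nat 4).mul ha₄).mul (hε.pow 3)).add
      (((isAlgebraic_nat 3).mul ha₃).mul (hε.pow 2))).add (((isAlgebraic_nat 2).mul ha₂).mul hε)).add ha₁
  -- abbreviate `c := c₃ = q′(ε)` everywhere
  generalize hc : 4 * a₄ * ε ^ 3 + 3 * a₃ * ε ^ 2 + 2 * a₂ * ε + a₁ = c at hder hcalg ⊢
  have hσ := r.isSemialgebraic_domain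
  have hmem : ∀ p ∈ r.domain, M₀ < p 0 := fun p hp => by rw [hdom] at hp; exact hp
  have hgt : ∀ p ∈ r.domain, ε < p 0 := fun p hp => hlt.trans (hmem p hp)
  have hMε : 0 < M₀ - ε := sub_pos.2 hlt
  -- the chart `φ x = c/(x − ε)` and its derivative `φ′ x = −c/(x − ε)²` are semialgebraic
  have h1 : IsSemialgebraicFunOn ℚ r.domain (fun p => p 0 - ε) :=
    (isSemialgebraicFunOn_apply hσ 0).fun_sub (isSemialgebraicFunOn_const_of_isAlgebraic hσ hε)
  have hφ : IsSemialgebraicFunOn ℚ r.domain (fun p => c / (p 0 - ε)) :=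
    ((isSemialgebraicFunOn_const_of_isAlgebraic hσ hcalg).fun_mul h1.fun_inv).congr
      fun p _ => by rw [div_eq_mul_inv]
  have hφ' : IsSemialgebraicFunOn ℚ r.domain (fun p => -(c / (p 0 - ε) ^ 2)) :=
    ((isSemialgebraicFunOn_const_of_isAlgebraic hσ hcalg).fun_mul (h1.fun_pow 2).fun_inv).fun_neg.congr
      fun p _ => by rw [div_eq_mul_inv]
  have hderiv : ∀ p ∈ r.domain, HasDerivAt (fun t : ℝ => c / (t - ε)) (-(c / (p 0 - ε) ^ 2)) (p 0) := by
    intro p hp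
    have hne : p 0 - ε ≠ 0 := (sub_pos.2 (hgt p hp)).ne'
    refine ((hasDerivAt_const (p 0) c).div ((hasDerivAt_id' (p 0)).sub_const ε) hne).congr_deriv ?_
    ring
  have hne : ∀ p ∈ r.domain, -(c / (p 0 - ε) ^ 2) ≠ 0 := fun p hp =>
    neg_ne_zero.2 (div_pos hder (pow_pos (sub_pos.2 (hgt p hp)) 2)).ne'
  have hinj : InjOn (fun p : Fin 1 → ℝ => fun _ : Fin 1 => c / (p 0 - ε)) r.domain := by
    intro p hp p' hp' h
    have h0 : c / (p 0 - ε) = c / (p' 0 - ε) := congrFun h 0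
    have ha : 0 < p 0 - ε := sub_pos.2 (hgt p hp)
    have hb : 0 < p' 0 - ε := sub_pos.2 (hgt p' hp')
    rw [div_eq_div_iff ha.ne' hb.ne'] at h0
    have h3 : p' 0 - ε = p 0 - ε := mul_left_cancel₀ hder.ne' h0
    have : p 0 = p' 0 := by linarith
    rw [KZ.eq_const_apply_zero p, KZ.eq_const_apply_zero p', this]
  obtain ⟨s, hs, hsi, hrel⟩ := helper_cells_1 r (fun t => c / (t - ε)) (fun t => -(c / (t - ε) ^ 2))
    hφ hφ' hderiv hne hinj
  refine ⟨s, ?_, ?_, ?_, hrel⟩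
  · -- the image of `(M₀, ∞)` is `(0, c/(M₀ − ε))`
    rw [hs]
    ext z
    constructor
    · rintro ⟨p, hp, rfl⟩
      have ha : 0 < p 0 - ε := sub_pos.2 (hgt p hp)
      have hlt' : M₀ - ε < p 0 - ε := by linarith [hmem p hp]
      exact ⟨div_pos hder ha, div_lt_div_of_pos_left hder hMε hlt'⟩
    · intro hz
      obtain ⟨hx, hφx⟩ := quarticTail_inv hder hlt hz
      refine ⟨fun _ => ε + c / z 0, by rw [hdom]; exact hx, ?_⟩
      rw [KZ.eq_const_apply_zero z]
      funext i
      exact hφx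
  · -- the integrand of the push-forward is `c₀/√D`
    intro z hz
    rw [hs] at hz
    obtain ⟨p, hp, rfl⟩ := hz
    have hx : ε < p 0 := hgt p hp
    dsimp only
    rw [hsi p hp, hint p hp, quarticTail_sqrt hq hc hder hx, abs_neg,
      abs_of_pos (div_pos hder (pow_pos (sub_pos.2 hx) 2)), div_div, mul_comm]
  · -- positivity of `D` on the image cell, inherited from `q > 0` on `(M₀, ∞) ⊆ (ε, ∞)`
    intro v hv
    obtain ⟨hx, hφx⟩ := quarticTail_inv hder hlt hv
    have hxε : ε < ε + c / v := hlt.trans hx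
    have key := quarticTail_identity hq hc hxε.ne'
    rw [hφx] at key
    rw [key]
    exact mul_pos (pow_pos (div_pos hder (pow_pos (sub_pos.2 hxε) 2)) 2) (hpos _ hxε)

end QuarticLayer

end Summit.KontsevichZagierPeriods.SymplecticScissors.RealOnePeriodRelations

end
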